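import Literature.AlgebraicGeometry.AbelianSchemes.AbelianSchemeConstSubgroupQuotientOfField
import Literature.AlgebraicGeometry.AbelianSchemes.AbelianSchemeConstSubgroupQuotientPoints
import Literature.AlgebraicGeometry.AbelianSchemes.LevelBasisFiniteEtaleCover
import Literature.AlgebraicGeometry.AbelianSchemes.LevelStructureTwist
import Literature.AlgebraicGeometry.AbelianSchemes.LevelStructureOfAlgClosedField
import Literature.AlgebraicGeometry.AbelianSchemes.LevelStructureRangeOfTorsionSections
import Literature.AlgebraicGeometry.AbelianSchemes.PoincarePullbackStabilizerOfLevelGeometric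
import Literature.AlgebraicGeometry.AbelianSchemes.SerreTensorIsogeny
import Literature.AlgebraicGeometry.Morphisms.FiniteEtaleSubschemeOfSplit
import HarnessLib

/-!
# The kernel law of `A → A⁄A[𝔟](S)` in the IDEAL shape: `t ≫ q = 1 ↔ ∀ c ∈ 𝔟, t ≫ ι(c) = 1` on all `T`-points

Layer `Literature/AlgebraicGeometry/AbelianSchemes`, namespace `Literature.AlgebraicGeometry.AbelianSchemes.AbelianSchemeOver`.
THEOREMS ONLY (no definition, no named fact, no instance, no notation, no `sorry`).  Cell `hodgecm-mathlib` (D-0151),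
FLOOR-0 programme, crux `hLiu418` D-line L3 leaf `Cruxes/HLiu418/Lines/F0_P6a_StubFROB.lean` socket `stub_ROOF0`, road (ρ-𝔟)
«DUAL-Q AT x̄″» (LA3-plan (g0) RULING «DUAL-B̄» #6 (2) ∕ DEAL UPDATE 2026-09-02T05:05:48Z, organ (b5)); author LA3-p03 (g2);
count-neutral capital (`--supports stmt-HodgeConjecture-24832`).  HC_CM is proved only modulo the 7 printed citations until
rung 0 closes; nothing in this file is about HC.

## Statement

Let `A → S` be an abelian scheme with commutative group law over a PRECONNECTED base `S` on which `n` is invertible, carrying a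
level-`n` structure `φ` ([MumfordFogartyKirwan1994] Ch. 7 §2 Def. 7.1), let `ι : O → End_S(A)` be a ring action and `𝔟 ⊆ O` an
ideal CONTAINING `n`.  Let `K := A[𝔟](S) = {σ ∈ A(S) | ∀ c ∈ 𝔟, σ ≫ ι(c) = 1}` (the full group of `𝔟`-torsion sections).  Then
for every `S`-scheme `T` and every `T`-point `t : T → A`:

* `forall_comp_i_eq_one_iff_exists_openCover_of_levelStructure` — `t` is killed by `𝔟` (`∀ c ∈ 𝔟, t ≫ ι(c) = 1`) iff,
  LOCALLY ON `T`, `t` is the restriction of a member of `K`.  («`A[𝔟] ⊆ A[n]` is the constant group scheme on its sections»: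
  `A[n] → S` is finite étale ([GortzWedhorn2023] Prop. 27.188 (1), ★ `exists_torsion_subscheme`) and SPLIT by the `n^{2g}` level
  sections, so every `T`-point of `A[n]` is locally one of them (★ `Morphisms.exists_openCover_comp_eq_section`,
  [GortzWedhorn2020] Prop. 9.3∕9.5); membership of the local section in `K` is read off at one geometric point of the member
  (`LevelStructure.basis_injective`) — the template of ★ `AbelianSchemeKOfLConstantOfLevelStructure`.)
* `comp_quotientMk_eq_one_iff_forall_comp_i_eq_one_of_field` — over an ALGEBRAICALLY CLOSED field `Ω` with `(n : Ω) ≠ 0`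
  (a level-`n` structure exists, ★ `nonempty_levelStructure_of_isAlgClosed`; `K` finite): for the free quotient
  `q : A → A⁄K` of [MumfordAV1970] §7 Thm. 4 (★ `quotientBy … of_field`),
  `t ≫ q = 1 ↔ ∀ c ∈ 𝔟, t ≫ ι(c) = 1` on ALL `T`-points — the kernel law of `q` IN THE IDEAL SHAPE, i.e. `ker q = A[𝔟]` as
  subgroup functors («`K = ker f`», [MumfordAV1970] §7 Thm. 4 (p. 72), combined with ★ `comp_quotientMk_eq_one_iff_exists_openCover`).
  This is EXACTLY the `hker` binder of ★ `IdealTorsionQuotientClassInvariance.exists_iso_of_kernelLaw_idealTorsion_of_classEq`.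

## References

* [MumfordAV1970] D. Mumford, *Abelian Varieties* (1970), §7 Thm. 4 (p. 72) («`K = ker f`»).
* [MumfordFogartyKirwan1994] D. Mumford, J. Fogarty, F. Kirwan, *Geometric Invariant Theory*, 3rd ed. (1994), Ch. 7 §2
  Definition 7.1 (p. 129) and Prop. 7.3, proof, step (IV) (pp. 133–134) (`A[n]` is constant over a level-`n` base).
* [GortzWedhorn2023] U. Görtz, T. Wedhorn, *Algebraic Geometry II* (2023), Prop. 27.188 (1) (p. 675).
* [GortzWedhorn2020] U. Görtz, T. Wedhorn, *Algebraic Geometry I*, 2nd ed. (2020), Prop. 9.3 and Prop. 9.5.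
* [SGA1] A. Grothendieck, *SGA 1*, Exp. V Prop. 2.6 (iii).
-/

set_option autoImplicit false
set_option backward.isDefEq.respectTransparency false

noncomputable section

universe u v

open CategoryTheory CategoryTheory.Limits AlgebraicGeometry MonoidalCategory CartesianMonoidalCategory
open scoped MonObj

namespace Literature.AlgebraicGeometry.AbelianSchemes

open Literature.AlgebraicGeometry.Morphisms Literature.AlgebraicGeometry.RelativeSpec

namespace AbelianSchemeOver

section General

variable {S : Scheme.{u}} (A : AbelianSchemeOver S) [IsCommMonObj A.X] {O : Type v} [CommRing O] (act : A.RingAction O)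

/-- The unit `T`-point of `A` is the structure morphism followed by the unit section: `(1 : T → A) = (T → S) ≫ (1 : S → A)` on
underlying schemes. [cite: GortzWedhorn2023, Def./Rem. 27.1 (p. 604)] -/
theorem one_left_eq_hom_comp_one_section_left (T : Over S) : (1 : T ⟶ A.X).left = T.hom ≫ (1 : A.Sections).left := by
  rw [← MonObj.comp_one (toUnit T), Over.comp_left, Over.toUnit_left]

/-- A `T`-point killed by an ideal containing `n` is `n`-torsion (`ι(n) = [n]`, ★ `RingAction.i_natCast`).
[cite: MumfordAV1970, §19 Thm. 3 (p. 176) and Cor. 1 (p. 178)] -/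
theorem pow_eq_one_of_forall_comp_i_eq_one_of_natCast_mem {n : ℕ} {𝔟 : Ideal O} (hn𝔟 : (n : O) ∈ 𝔟) {Y : Over S}
    (z : Y ⟶ A.X) (hz : ∀ c ∈ 𝔟, z ≫ act.i c = 1) : z ^ n = 1 := by
  have h : z ^ n = z ≫ act.i (n : O) := by rw [act.i_natCast, MonObj.comp_pow, Category.comp_id]
  rw [h]
  exact hz _ hn𝔟

/-- **`A[𝔟]` IS THE CONSTANT SUBGROUP SCHEME ON ITS SECTIONS over a preconnected level-`n` base, `n ∈ 𝔟`**: a `T`-point `t` of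
`A` is killed by every `ι(c)`, `c ∈ 𝔟`, iff locally on `T` it is the restriction of a section `σ ∈ K = A[𝔟](S)`.
(⇒: `t` is `n`-torsion, so a `T`-point of the finite étale `A[n]` (★ `exists_torsion_subscheme`), which is split by the level
sections `σ^a` — hence locally `t = σ^a|_T` (★ `exists_openCover_comp_eq_section`); on a non-empty member, `σ^a ≫ ι(c)` and `1` are
`n`-torsion sections agreeing at a geometric point, hence equal (`basis_injective` + every `n`-torsion section is some `σ^b`,
★ `exists_comp_eq_section_of_preconnectedSpace`), so `σ^a ∈ K`; on an empty member take `σ := 1`.  ⇐: glue along the cover.)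
[cite: MumfordFogartyKirwan1994, Ch. 7 §2 Prop. 7.3, proof (IV) (pp. 133–134)] [cite: GortzWedhorn2023, Prop. 27.188 (1) (p. 675)]
[cite: MumfordAV1970, §7 Thm. 4 (p. 72)] -/
theorem forall_comp_i_eq_one_iff_exists_openCover_of_levelStructure [PreconnectedSpace S] {g n : ℕ} [NeZero n]
    (hn : ∀ s : S, (n : S.residueField s) ≠ 0) (φ : LevelStructure g n A) {𝔟 : Ideal O} (hn𝔟 : (n : O) ∈ 𝔟)
    (K : Subgroup A.Sections) (hK : ∀ σ : A.Sections, σ ∈ K ↔ ∀ c ∈ 𝔟, σ ≫ act.i c = 1) (T : Over S) (t : T ⟶ A.X) :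
    (∀ c ∈ 𝔟, t ≫ act.i c = 1) ↔
      ∃ 𝒱 : Scheme.OpenCover.{u} T.left, ∀ j, ∃ σ : K, 𝒱.f j ≫ t.left = 𝒱.f j ≫ T.hom ≫ (σ : A.Sections).left := by
  classical
  -- (0) the finite étale `A[n] ↪ A` and its splitting sections `w a` lifting the level sections `σ^a`
  obtain ⟨AM, incl, hfinAM, hetAM, hpowM, hlift, hinj⟩ := A.exists_torsion_subscheme hn
  haveI := hfinAM
  haveI := hetAM
  have hsM : ∀ a : Fin g ⊕ Fin g → ZMod n, A.sectionPow φ.σ a ^ n = 1 := fun a => A.sectionPow_pow_eq_one φ.pow_σ a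
  choose w hw using fun a => hlift (𝟙_ (Over S)) (A.sectionPow φ.σ a) (hsM a)
  have hφq : ∀ a, (w a).left ≫ AM.hom = 𝟙 S := fun a => Over.w (w a)
  have hsplit : ∀ ⦃Ω : Type u⦄ [Field Ω] [IsAlgClosed Ω] (y : Spec (.of Ω) ⟶ AM.left),
      ∃ a, y = (y ≫ AM.hom) ≫ (w a).left := by
    intro Ω _ _ y
    let yo : Over.mk (y ≫ AM.hom) ⟶ AM := Over.homMk y rfl
    obtain ⟨a, ha⟩ := φ.basis_surjective (y ≫ AM.hom) (yo ≫ incl) (hpowM _ yo)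
    refine ⟨a, ?_⟩
    have h1 : toUnit (Over.mk (y ≫ AM.hom)) ≫ w a = yo :=
      hinj _ _ _ (by rw [Category.assoc, hw]; exact ha)
    have h2 : (toUnit (Over.mk (y ≫ AM.hom)) ≫ w a).left = yo.left := by rw [h1]
    rw [Over.comp_left, Over.toUnit_left] at h2
    change (y ≫ AM.hom) ≫ (w a).left = y at h2
    exact h2.symm
  -- (1) over a non-empty (preconnected) base every `n`-torsion section is some `σ^a`
  have hexists : Nonempty S → ∀ τ : A.Sections, τ ^ n = 1 → ∃ a : Fin g ⊕ Fin g → ZMod n, τ = A.sectionPow φ.σ a := by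
    intro hne τ hτ
    haveI := hne
    obtain ⟨wτ, hwτ⟩ := hlift _ τ hτ
    haveI : Nonempty ↥((𝟙_ (Over S)).left) := hne
    haveI : PreconnectedSpace ↥((𝟙_ (Over S)).left) := ‹PreconnectedSpace S›
    obtain ⟨a, ha⟩ := exists_comp_eq_section_of_preconnectedSpace AM.hom (fun a => (w a).left) hφq hsplit
      wτ.left (𝟙_ (Over S)).hom (Over.w wτ)
    refine ⟨a, ?_⟩
    rw [← hwτ, ← hw a]
    congr 1
    exact Over.OverMorphism.ext (ha.trans (Category.id_comp _))
  -- (2) `1 ∈ K`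
  have h1K : (1 : A.Sections) ∈ K := (hK 1).2 fun c _ => by
    haveI := act.isMonHom c
    exact MonObj.one_comp (act.i c)
  constructor
  · -- (⇒) `t` is `n`-torsion, hence a `T`-point of `A[n]`, hence locally a level section
    intro ht
    obtain ⟨v, hv⟩ := hlift T t (A.pow_eq_one_of_forall_comp_i_eq_one_of_natCast_mem act hn𝔟 t ht)
    obtain ⟨𝒱, h𝒱⟩ := exists_openCover_comp_eq_section AM.hom (fun a => (w a).left) hφq hsplit v.left T.hom (Over.w v)
    refine ⟨𝒱, fun j => ?_⟩
    obtain ⟨a, ha⟩ := h𝒱 j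
    -- the member equation for `t`
    have hmem : 𝒱.f j ≫ t.left = 𝒱.f j ≫ T.hom ≫ (A.sectionPow φ.σ a).left := by
      have e1 : t.left = v.left ≫ incl.left := by rw [← hv]; rfl
      have e2 : (A.sectionPow φ.σ a).left = (w a).left ≫ incl.left := by rw [← hw a]; rfl
      have hk' := congrArg (· ≫ incl.left) ha
      simp only [Category.assoc] at hk'
      rw [e1, e2]
      exact hk'
    rcases isEmpty_or_nonempty (𝒱.X j) with hj | hj
    · -- empty member: any section of `K` will do
      exact ⟨⟨1, h1K⟩, Limits.IsInitial.hom_ext isInitialOfIsEmpty _ _⟩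
    · refine ⟨⟨A.sectionPow φ.σ a, (hK _).2 fun c hc => ?_⟩, hmem⟩
      haveI := act.isMonHom c
      -- `σ^a ≫ ι(c)` and `1` agree after `𝒱ⱼ → T → S`
      have heq : (𝒱.f j ≫ T.hom) ≫ (A.sectionPow φ.σ a ≫ act.i c).left = (𝒱.f j ≫ T.hom) ≫ (1 : A.Sections).left := by
        have h2 : 𝒱.f j ≫ (t ≫ act.i c).left = (𝒱.f j ≫ T.hom ≫ (A.sectionPow φ.σ a).left) ≫ (act.i c).left := by
          rw [Over.comp_left, ← Category.assoc, hmem]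
        rw [ht c hc, A.one_left_eq_hom_comp_one_section_left] at h2
        rw [Over.comp_left]
        simp only [Category.assoc] at h2 ⊢
        exact h2.symm
      -- read it at a geometric point of the member
      obtain ⟨x0⟩ := hj
      let Ω' : Type u := AlgebraicClosure ((𝒱.X j).residueField x0)
      let ybar : Spec (.of Ω') ⟶ 𝒱.X j :=
        Spec.map (CommRingCat.ofHom (algebraMap ((𝒱.X j).residueField x0) Ω')) ≫ (𝒱.X j).fromSpecResidueField x0
      obtain ⟨s', hs'⟩ : ∃ s' : Spec (.of Ω') ⟶ S, s' = ybar ≫ 𝒱.f j ≫ T.hom := ⟨_, rfl⟩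
      have hS : Nonempty S := ⟨s'.base (IsLocalRing.closedPoint Ω')⟩
      have hres : ∀ τ : A.Sections, (A.restrict s' τ).left = s' ≫ τ.left := fun τ => by
        change (toUnit (Over.mk s') ≫ τ).left = _
        rw [Over.comp_left, Over.toUnit_left]
        rfl
      have heq' : A.restrict s' (A.sectionPow φ.σ a ≫ act.i c) = A.restrict s' (1 : A.Sections) := by
        apply Over.OverMorphism.ext
        rw [hres, hres, hs']
        have h3 := congrArg (ybar ≫ ·) heq
        simp only [Category.assoc] at h3 ⊢
        exact h3
      -- both are `n`-torsion sections, hence level sections, hence equal by `basis_injective`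
      have hσn : (A.sectionPow φ.σ a ≫ act.i c) ^ n = 1 := by
        rw [← MonObj.pow_comp, hsM a, MonObj.one_comp]
      obtain ⟨b₁, hb₁⟩ := hexists hS _ hσn
      obtain ⟨b₀, hb₀⟩ := hexists hS (1 : A.Sections) (one_pow n)
      rw [hb₁, hb₀] at heq'
      have hb : b₁ = b₀ := φ.basis_injective s' heq'
      rw [hb₁, hb, ← hb₀]
  · -- (⇐) glue: on each member `t` is a section of `K`, which is killed by `𝔟`
    rintro ⟨𝒱, h𝒱⟩ c hc
    haveI := act.isMonHom c
    apply Over.OverMorphism.ext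
    refine 𝒱.hom_ext _ _ fun j => ?_
    obtain ⟨σ, hσ⟩ := h𝒱 j
    have hσc : (σ : A.Sections) ≫ act.i c = 1 := (hK _).1 σ.2 c hc
    have hσc' : (σ : A.Sections).left ≫ (act.i c).left = (1 : A.Sections).left := by rw [← Over.comp_left, hσc]
    change 𝒱.f j ≫ (t ≫ act.i c).left = 𝒱.f j ≫ (1 : T ⟶ A.X).left
    rw [Over.comp_left, ← Category.assoc, hσ, A.one_left_eq_hom_comp_one_section_left, ← hσc']
    simp only [Category.assoc]

end General

/-! ## §2 Over an algebraically closed field: the kernel law of `A → A⁄A[𝔟](Ω)` in the ideal shape -/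

section Field

variable {Ω : Type u} [Field Ω] [IsAlgClosed Ω] (A : AbelianSchemeOver (Spec (.of Ω)))
  [IsSeparated (A.X.hom ≫ 𝟙 (Spec (.of Ω)))] [LocallyOfFiniteType (A.X.hom ≫ 𝟙 (Spec (.of Ω)))]
  {O : Type v} [CommRing O] (act : A.RingAction O)

omit [IsSeparated (A.X.hom ≫ 𝟙 (Spec (.of Ω)))] [LocallyOfFiniteType (A.X.hom ≫ 𝟙 (Spec (.of Ω)))] in
/-- **Over an algebraically closed field: killed by `𝔟` iff locally a section of `A[𝔟](Ω)`** (`(n : Ω) ≠ 0`, `n ∈ 𝔟`; the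
level-`n` structure exists by ★ `nonempty_levelStructure_of_isAlgClosed`). [cite: MumfordFogartyKirwan1994, Ch. 7 §2 Prop. 7.3, proof (IV) (pp. 133–134)]
[cite: MumfordAV1970, §7 Thm. 4 (p. 72)] -/
theorem forall_comp_i_eq_one_iff_exists_openCover_of_field {g : ℕ} (hA : A.IsOfRelDim g) {n : ℕ} (hn0 : (n : Ω) ≠ 0)
    {𝔟 : Ideal O} (hn𝔟 : (n : O) ∈ 𝔟) (K : Subgroup A.Sections) (hK : ∀ σ : A.Sections, σ ∈ K ↔ ∀ c ∈ 𝔟, σ ≫ act.i c = 1)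
    (T : Over (Spec (.of Ω))) (t : T ⟶ A.X) :
    (∀ c ∈ 𝔟, t ≫ act.i c = 1) ↔
      ∃ 𝒱 : Scheme.OpenCover.{u} T.left, ∀ j, ∃ σ : K, 𝒱.f j ≫ t.left = 𝒱.f j ≫ T.hom ≫ (σ : A.Sections).left := by
  haveI := A.isCommMonObj_of_field
  haveI : NeZero n := ⟨by rintro rfl; exact hn0 Nat.cast_zero⟩
  haveI := preconnectedSpace_spec_field (Ω := Ω)
  obtain ⟨φ⟩ := A.nonempty_levelStructure_of_isAlgClosed (n := n) hA hn0
  exact A.forall_comp_i_eq_one_iff_exists_openCover_of_levelStructure act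
    (fun s => natCast_residueField_ne_zero_of_specMap (𝟙 (Spec (.of Ω))) s hn0) φ hn𝔟 K hK T t

/-- **THE KERNEL LAW OF `q : A → A⁄A[𝔟](Ω)` IN THE IDEAL SHAPE** (organ (b5)): `Ω` algebraically closed, `(n : Ω) ≠ 0`, `n ∈ 𝔟`,
`K = A[𝔟](Ω)` the (finite) group of sections killed by `𝔟`, `q` the free quotient by `K` ([MumfordAV1970] §7 Thm. 4, ★
`quotientBy … of_field`).  Then for every `T`-point `t` of `A`: `t ≫ q = 1 ↔ ∀ c ∈ 𝔟, t ≫ ι(c) = 1` — `ker q = A[𝔟]` as subgroup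
functors; the `hker` binder of ★ `exists_iso_of_kernelLaw_idealTorsion_of_classEq`. [cite: MumfordAV1970, §7 Thm. 4 (p. 72)]
[cite: MumfordFogartyKirwan1994, Ch. 7 §2 Prop. 7.3, proof (IV) (pp. 133–134)] -/
theorem comp_quotientMk_eq_one_iff_forall_comp_i_eq_one_of_field {g : ℕ} (hA : A.IsOfRelDim g) {n : ℕ} (hn0 : (n : Ω) ≠ 0)
    {𝔟 : Ideal O} (hn𝔟 : (n : O) ∈ 𝔟) (K : Subgroup A.Sections) [Finite K]
    (hK : ∀ σ : A.Sections, σ ∈ K ↔ ∀ c ∈ 𝔟, σ ≫ act.i c = 1) ⦃T : Over (Spec (.of Ω))⦄ (t : T ⟶ A.X) :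
    t ≫ (show A.X ⟶ (A.quotientBy (𝟙 (Spec (.of Ω))) K (A.hcov_of_field K)
        (A.exists_grpObj_isMonHom_quotientMk_of_field K (A.hcov_of_field K))
        (A.smooth_quotientOver_hom_of_field K (A.hcov_of_field K))
        (A.geometricallyConnected_quotientOver_hom (𝟙 (Spec (.of Ω))) K (A.hcov_of_field K))).X from
        A.quotientMk (𝟙 (Spec (.of Ω))) K (A.hcov_of_field K)) = 1 ↔ ∀ c ∈ 𝔟, t ≫ act.i c = 1 := by
  haveI := A.isCommMonObj_of_field
  rw [A.comp_quotientMk_eq_one_iff_exists_openCover (𝟙 (Spec (.of Ω))) K (A.hcov_of_field K)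
    (A.exists_grpObj_isMonHom_quotientMk_of_field K (A.hcov_of_field K))
    (A.smooth_quotientOver_hom_of_field K (A.hcov_of_field K))
    (A.geometricallyConnected_quotientOver_hom (𝟙 (Spec (.of Ω))) K (A.hcov_of_field K)) (A.translation_free_of_field K) t]
  exact (A.forall_comp_i_eq_one_iff_exists_openCover_of_field act hA hn0 hn𝔟 K hK T t).symm

end Field

end AbelianSchemeOver

end Literature.AlgebraicGeometry.AbelianSchemes

end
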